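import Literature.MathematicalPhysics.QuantumFieldTheory.Balaban1983to89.B9Eq3130GtildeGradRowClosed
import Literature.MathematicalPhysics.QuantumFieldTheory.Balaban1983to89.B9Eq3152BareHessianGaugeModeTower

/-!
# `Balaban1983to89.B9Eq3152GtildeThirdWordSupRowClosed` — T. Bałaban, *Propagators for lattice gauge theories in a background field*, Commun. Math. Phys. **99**
# (1985) 389–434 [Balaban1985BackgroundPropagators] (3.152) p. 426 *«G₁DR = DG′R»*, (3.147) p. 425 (*«𝔓 = I − G₁Q\*(QG₁Q\*)⁻¹Q − G₁DRD\*»*), (3.153) p. 426,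
# (3.124) p. 420, (3.119) p. 419, Thm 3.13 p. 426, with [Balaban1985Variational] (110)–(111) p. 294, (117) p. 295: **(3.152) HOLDS EXACTLY FOR PRINT's
# `G̃_k = Δ̃_{a,k}(U)⁻¹` — `G̃_k(D_U(R_kμ)) = D_U(G′_k(R_kμ))`, no correction term (`π_k` kills the gauge modes) — AND THE SUP ROW OF THE THIRD WORD
# `G̃_kD_UR_kD*_UG̃_k` OF `𝔊̃_k = G̃_k𝔓_k*` ON THE CELL's DIAGONAL, `∃ (α₁, B, δ)` FIRST: ONE `letter_comp` of the divergence row of `G̃_k`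
# (`B9Eq3130GtildeGradRowClosed`, this lineage) with ne9-leaf-05's (K70) gradient letter of `G′_kR_k`** (ruling R-ne9p1-g97-4 (2)(c))

statement-level skeleton of published theorems with citation tags; proofs where landed; nothing here is a claim about the Yang–Mills mass gap

CITATION HEADER (lean-in-tree rule).  Audit cell `pub-balaban`, sub-cell `t4`, BINDER row NE9; filed by the NE9 BINDER-row OWNER lineage `b2b-balaban-t4-ne9-p1`
(gen 97; INTENT-6, journal `HOME/CLAIMS.log`; ruling R-ne9p1-g97-4 (2)(c) — first refusal had been ne9-leaf-03's, whose seat closed for the night).  Source READ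
first-hand this generation (`paper:balaban1985-cmp99-background-propagators`, journal page = PDF page + 388): p. 426 (3.152)–(3.153), p. 425 (3.147) and «RD*G₁DR =
R», p. 420 (3.124), p. 419 (3.119), p. 422 (3.131)–(3.133).  COMPOSED BY NAME, nothing restated: `B9Eq3124GaugeModes.G1K_gaugeMode` (the operator form of (3.152)
on gauge modes, this lineage) with (g1) := `B9Eq3119InvariantExtension.invariantExtension_apply_eq_zero` ∘ `B9Eq3119DeltaPiTower.piOfUk_gaugeMode` ∘
`B9Eq324DeltaPrimeATower.GpOfUk_gaugeMode`, (g2) := ne9-leaf-02's (3.115) `B9Eq3115QkGaugeModeTower.QkW_covDerivL2K_eq_zero_of_QprimeTowerW_eq_zero`, (g3) :=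
`B11Eq103H1Complex.RLatticeK_apply_of_ker`, at the NAMED gauge parameter `n′ = G′_k(R_kμ)` of ne9-leaf-03 g80's (BHG) `B9Eq3152BareHessianGaugeModeTower`
(`QprimeTowerW_GpOfUk_RofUk`, `covDivL2K_covDerivL2K_GpOfUk_RofUk`); the rows: this lineage's (T4B) `B9Eq3130GtildeGradRowClosed.exists_local_rows_G1kPi`
(conjunct 2, the divergence row) and ne9-leaf-05 g87's (K70) `B9Eq3152GreenPrimeProjGradRowClosed.exists_local_gradLetter_GpRk`, ne9-leaf-05's (K61) `letter_comp`.

WHAT IS PROVED (sorry-free; proof lane — 0 `def`; [folklore]).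
* §1 **`G1LatticeKPi_covDerivL2K_RofUk`** — for every site function `μ`: `G̃_k(D_U(R_kμ)) = D_Un′`, `n′ := G′_k(R_kμ)` (`G̃_k = G1LatticeK hposπ` at print's
  operator (3.122) `laplaceAkPi`; compare (BHG)'s `G1k_covDerivL2K_RofUk` for `G₀ = G1k`, which carries the correction `− G1k(Δ^η(D_Un′))`).
* §2 **`exists_local_letter_thirdWord_G1kPi`** — `∃ α₁ B δ, 0 < α₁ ∧ 0 ≤ B ∧ 0 < δ ∧ ∀ ⟨(T4B)'s binder block VERBATIM through `hJ`⟩ (v f F) (f supported over the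
  unit block `v` at `Π(b₋)`, `‖f‖_∞ ≤ F`) (b), ‖(G̃_k(D_U(R_k(D*_U(G̃_kf)))))(b)‖ ≤ B·e^{−δ·d_m(Π(b₊),v)}·F` — the VALUE row of the third word of `𝔊̃_k = G̃_k −
  G̃_kQ_k†(Q_kG̃_kQ_k†)⁻¹Q_kG̃_k − G̃_kD_UR_kD*_UG̃_k`; constants `α₁ = min`, `δ = min(δ_R, δ₃)∕2`, `B = B_R·B₃·K_d(δ₃ − δ)`.
HONEST SCOPE.  One identity from landed gauge-mode lemmas and one composition of landed `∃`-first letters; the word's GRADIENT row (second derivatives of `G′_k` on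
a sup input) is STOREY H material (R-ne9p1-g97-3, Q-117-∇) and is NOT here; the middle word and the (117) socket are NOT here (R-4 (2)(b)(d)); `hposπ`, `hc₀`, `hJ`
stay DISPLAYED (inhabited elsewhere: `B9Thm311LaplaceAkPiPositiveDiagonal`, `c₁ = 1`, lit-balaban's `B9Eq336CurrentBound`); nothing of [B9] (3.124), (3.147),
(3.152)–(3.153), Thm 3.3∕3.13 or [B11] (110)–(111)∕(117) is asserted, valued or discharged; «NE9 ⇐ the named binders»; NE9 NOT PRINTED ∕ NOT PROVED; row WALLED ON
A MODEL (O-NE9-1; #5 UNRULED); spine PROVED 0∕9; rung (B)+1 on a finite T⁴ — NOT infinite volume, NOT mass gap, NOT BetaPertH, NOT Clay.  HONEST DEPENDENCY: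
continuum YM on T⁴ ⇐ BetaPertH ∧ nine spine estimates (0/9 proved); BetaPertH ⇐ (D1) ∧ (D4) ∧ CAP+tail; G-an2-4 gates asym, D1 and NE2/3/4.  NEW file importing two
BUILT-or-landing modules (`B9Eq3130GtildeGradRowClosed`, `B9Eq3152BareHessianGaugeModeTower`); nothing modified.  Net new unproved facts: 0.
-/

noncomputable section

set_option autoImplicit false

open scoped InnerProductSpace ComplexConjugate BigOperators

namespace Literature.MathematicalPhysics.QuantumFieldTheory.Balaban1983to89.B9Eq3152GtildeThirdWordSupRowClosed

open B4Sect5Torus (TSite tdist tdist_nonneg tdist_triangle torusSum_le)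
open B4Sect5Proof (latticeConst latticeConst_nonneg)
open B9SectCLatticeCarrier (Bond bpos btgt unshift)
open B9Eq311L2Pairing (WL2)
open B9Eq319QprimeTorus (blockCoord)
open B7Prop1Explicit (U1 Wcx boxVec)
open B11Eq103H1Complex (SiteL2K BondL2K covDerivL2K covDivL2K G1LatticeK RLatticeK_apply_of_ker)
open B9Eq310DeltaPrime (plaqHolU)
open B9Eq310HessianOperator (adTransportW hessOp)
open B9Eq315QTorus (perCfg cornerSite)
open B9Eq315QTower (towerP UlevOf)
open B9Eq316TowerFlatIsOneStep (towerP_eq_fineP_pow siteCast)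
open B9Eq326OperatorTower (QprimeTowerW QkW RofUk laplaceAk G1k)
open B9Eq324DeltaPrimeATower (laplacePrimeAk GpOfUk GpOfUk_gaugeMode)
open B9Eq3119DeltaPiTower (piOfUk laplaceAkPi piOfUk_gaugeMode)
open B9Eq3119InvariantExtension (invariantExtension_apply_eq_zero)
open B9Eq3124GaugeModes (G1K_gaugeMode)
open B9Eq3115QkGaugeModeTower (QkW_covDerivL2K_eq_zero_of_QprimeTowerW_eq_zero)
open B9Eq3152BareHessianGaugeModeTower (QprimeTowerW_GpOfUk_RofUk covDivL2K_covDerivL2K_GpOfUk_RofUk)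
open B9Eq326G1SupRowOfLetters (letter_comp)
open B9Eq3130GtildeGradRowClosed (exists_local_rows_G1kPi)
open B9Eq3152GreenPrimeProjGradRowClosed (exists_local_gradLetter_GpRk)

/-! ## §1 (3.152) exactly for print's `G̃_k` -/

section Identity

variable {d : ℕ} (L : ℕ) [NeZero L] (m : Fin d → ℕ) [∀ i, NeZero (m i)] (n : ℕ)
  {𝔸 : Type*} [NormedRing 𝔸] [NormedAlgebra ℂ 𝔸] [CompleteSpace 𝔸] [StarRing 𝔸] [StarModule ℂ 𝔸] [NormOneClass 𝔸]
  {W : Type*} [NormedAddCommGroup W] [InnerProductSpace ℂ W] [FiniteDimensional ℂ W] (φ : W ≃ₗ[ℂ] 𝔸) {c₀ c₁ : ℝ} [Fact (0 < c₀)] [Fact (0 < c₁)]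
  (τ : 𝔸 →ₗ[ℂ] ℂ) (η : ℝ) (U : Bond d (towerP L m (n + 1)) → 𝔸ˣ)
  (a' : ℝ) (hpos' : ∀ x : SiteL2K ℂ d (towerP L m (n + 1)) c₀ W, x ≠ 0 → 0 < RCLike.re ⟪x, laplacePrimeAk L m n φ η U a' (c₁ := c₁) x⟫_ℂ)
  (hL : 1 ≤ L) (αU : ℕ → ℝ) (hα1 : ∀ j, αU j ≤ 1 / 64)
  (hU1 : ∀ (j : ℕ) (x : B7Prop1Explicit.Site d) (κ : Fin d), perCfg (towerP L m (j + 1)) (UlevOf L m (n + 1) U j) x κ ∈ U1 𝔸)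
  (hreg : ∀ (j : ℕ) (y : TSite d (towerP L m j)) (κ : Fin d) (r : Fin d → Fin L),
    ‖((Wcx L (perCfg (towerP L m (j + 1)) (UlevOf L m (n + 1) U j)) (cornerSite L y) κ (boxVec L r) : 𝔸ˣ) : 𝔸) - 1‖ ≤ αU j)
  (a : ℝ)
  (hposπ : ∀ x : BondL2K ℂ d (towerP L m (n + 1)) c₀ W, x ≠ 0 →
    0 < RCLike.re ⟪x, laplaceAkPi L m n φ τ η U a' hpos' hL αU hα1 hU1 hreg (c₁ := c₁) a x⟫_ℂ)

/-- **(3.152) EXACTLY FOR PRINT's `G̃_k`: `G̃_k(D_U(R_kμ)) = D_Un′`, `n′ = G′_k(R_kμ)`** — `Δ̃_{a,k}(D_Un′) = D_U(R_k(D*_UD_Un′)) = D_U(R_kμ)` because `π_k(D_Un′) = 0`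
(`Q′_kn′ = 0`), `Q_k(D_Un′) = 0` ((3.115)) and `R_k` fixes `D*_UD_Un′`; `G1K_gaugeMode` at `l := n′`. [folklore]
[cite: Balaban1985BackgroundPropagators, (3.152) p.426, (3.119) p.419, (3.124) p.420, (3.115) p.418] -/
theorem G1LatticeKPi_covDerivL2K_RofUk (s : SiteL2K ℂ d (towerP L m (n + 1)) c₀ W) :
    G1LatticeK hposπ (covDerivL2K ℂ c₀ ((η : ℂ))⁻¹ (adTransportW φ U) (RofUk L m n φ η U s)) =
      covDerivL2K ℂ c₀ ((η : ℂ))⁻¹ (adTransportW φ U) (GpOfUk L m n φ η U a' hpos' (RofUk L m n φ η U s)) := by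
  have hn : QprimeTowerW L m n φ U (GpOfUk L m n φ η U a' hpos' (RofUk L m n φ η U s)) = 0 :=
    QprimeTowerW_GpOfUk_RofUk L m n φ η U a' hpos' s
  have hDD := covDivL2K_covDerivL2K_GpOfUk_RofUk L m n φ η U a' hpos' s
  have key := G1K_gaugeMode (hpos := hposπ) {l : SiteL2K ℂ d (towerP L m (n + 1)) c₀ W | QprimeTowerW L m n φ U l = 0}
    (fun l hl => invariantExtension_apply_eq_zero _ _
      (piOfUk_gaugeMode L m n φ η U _ (fun l' hl' => GpOfUk_gaugeMode L m n φ η U a' hpos' l' hl') hl))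
    (fun l hl => QkW_covDerivL2K_eq_zero_of_QprimeTowerW_eq_zero φ η L m n hL U αU hα1 hU1 hreg (c₀ := c₀) (c₁ := c₁) l hl)
    (fun l hl => RLatticeK_apply_of_ker _ _ _ _ hl) hn
  rw [hDD] at key
  exact key

end Identity

/-! ## §2 The sup row of the third word `G̃_kD_UR_kD*_UG̃_k`, `∃ (α₁, B, δ)` first -/

section Row

variable {d : ℕ} (hd : 1 ≤ d) (L : ℕ) [NeZero L] (hL : 1 ≤ L) (hL3 : 3 ≤ L)
  {𝔸 : Type*} [NormedRing 𝔸] [NormedAlgebra ℂ 𝔸] [CompleteSpace 𝔸] [NormOneClass 𝔸] [StarRing 𝔸] [NormedStarGroup 𝔸] [StarModule ℂ 𝔸]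
  {W : Type*} [NormedAddCommGroup W] [InnerProductSpace ℂ W] [FiniteDimensional ℂ W] (φ : W ≃ₗ[ℂ] 𝔸)
  {Mφ Mφ' : ℝ} (hMφ : 0 ≤ Mφ) (hMφ' : 0 ≤ Mφ') (hφ : ∀ w, ‖φ w‖ ≤ Mφ * ‖w‖) (hφ' : ∀ X, ‖φ.symm X‖ ≤ Mφ' * ‖X‖) (hstar : ∀ X : 𝔸, ‖star X‖ ≤ ‖X‖)
  {a : ℝ} (ha : 0 < a) {a' : ℝ} (ha' : 0 < a') {ϱ : ℝ} (hϱ0 : 0 ≤ ϱ) (hϱ1 : ϱ < 1)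
  (τ : 𝔸 →ₗ[ℂ] ℂ) {Cτ : ℝ} (hτ : ∀ X, ‖τ X‖ ≤ Cτ * ‖X‖) (hCτ : 0 ≤ Cτ) {Mτ : ℝ} (hτm : ∀ X Y : 𝔸, ‖τ (X * Y)‖ ≤ Mτ * ‖X‖ * ‖Y‖) (hMτ : 0 ≤ Mτ)
  {ρw : ℝ} (hρw : 0 ≤ ρw)
  (hτ₁ : ∀ X : 𝔸, τ (star X) = conj (τ X)) (hτ₂ : ∀ X Y : 𝔸, τ (X * Y) = τ (Y * X)) (hφτ : ∀ X Y : 𝔸, ⟪φ.symm X, φ.symm Y⟫_ℂ = τ (star X * Y))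
  (AQ : ℝ)

set_option maxHeartbeats 400000 in -- two ≈ 50-binder suppliers read once each + the CLM naming: the defeq assembly exceeds the default budget
include hd hL hL3 hMφ hMφ' hφ hφ' hstar ha ha' hϱ0 hϱ1 hτ hCτ hτm hMτ hρw hτ₁ hτ₂ hφτ in
/-- **THE SUP ROW OF THE THIRD WORD `G̃_kD_UR_kD*_UG̃_k`, `∃ (α₁, B, δ)` FIRST** on (T4B)'s block: `‖(G̃_k(D_U(R_k(D*_U(G̃_kf)))))(b)‖ ≤ B·e^{−δ·d_m(Π(b₊),v)}·F`
for `f` supported over the unit block `v` (bonds at `Π(b₋)`) with `‖f‖_∞ ≤ F` — by §1 the word is `D_UG′_kR_k ∘ D*_UG̃_k`, one `letter_comp` of the divergence row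
of `G̃_k` with (K70). [cite: Balaban1985BackgroundPropagators, (3.152)–(3.153) p.426, (3.147) p.425, Thm 3.13 p.426, Thm 3.1 (3.42) p.397; Balaban1985Variational,
(110)–(111) p.294, (117) p.295] -/
theorem exists_local_letter_thirdWord_G1kPi :
    ∃ α₁ B δ : ℝ, 0 < α₁ ∧ 0 ≤ B ∧ 0 < δ ∧
      ∀ (n : ℕ) (η : ℝ) (_hηL : η * (L : ℝ) ^ (n + 1) = 1) (c₀ c₁ : ℝ) [Fact (0 < c₀)] [Fact (0 < c₁)]
        (_hw : c₀ * ((L : ℝ) ^ (n + 1)) ^ d = c₁) (_hρ : |η| ^ d / c₀ ≤ ρw) (m : Fin d → ℕ) [∀ i, NeZero (m i)] (_hm : ∀ i, 1 ≤ m i)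
        (U : Bond d (towerP L m (n + 1)) → 𝔸ˣ) (αU : ℕ → ℝ) (_hα0 : ∀ j, 0 ≤ αU j) (hα1 : ∀ j, αU j ≤ 1 / 64)
        (hU1 : ∀ (j : ℕ) (x : B7Prop1Explicit.Site d) (k : Fin d), perCfg (towerP L m (j + 1)) (UlevOf L m (n + 1) U j) x k ∈ U1 𝔸)
        (hreg : ∀ (j : ℕ) (y : TSite d (towerP L m j)) (k : Fin d) (ρ' : Fin d → Fin L),
          ‖((Wcx L (perCfg (towerP L m (j + 1)) (UlevOf L m (n + 1) U j)) (cornerSite L y) k (boxVec L ρ') : 𝔸ˣ) : 𝔸) - 1‖ ≤ αU j)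
        (εU : ℕ → ℝ) (_hεU : ∀ j, 0 ≤ εU j) (_hUε : ∀ (j : ℕ) (b : Bond d (towerP L m (j + 1))), ‖(UlevOf L m (n + 1) U j b : 𝔸) - 1‖ ≤ εU j)
        (_hLb : ∀ (j : ℕ) (b : Bond d (towerP L m (j + 1))), UlevOf L m (n + 1) U j b ∈ U1 𝔸)
        (α : ℝ) (_hα : 0 ≤ α) (_hαle : α ≤ α₁)
        (hUst : ∀ b, star (U b : 𝔸) = (((U b)⁻¹ : 𝔸ˣ) : 𝔸)) (_hUb : ∀ b, U b ∈ U1 𝔸) (_hUη : ∀ b, ‖(U b : 𝔸) - 1‖ ≤ α * η)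
        (_hpl : ∀ p : B9SectCLatticeCarrier.Plaq d (towerP L m (n + 1)), ‖(plaqHolU U p : 𝔸) - 1‖ ≤ α * η ^ 2)
        (_hUgrad : ∀ (x : TSite d (towerP L m (n + 1))) (μ : Fin d), ‖(U (x, μ) : 𝔸) - U (unshift μ x, μ)‖ ≤ α * η ^ 2)
        (_hRlev : ∀ (j : ℕ) (b : Bond d (towerP L m (j + 1))) (w : W), ‖adTransportW φ (UlevOf L m (n + 1) U j) b w‖ ≤ ‖w‖)
        (_hεg : ∀ j < n + 1, εU j ≤ α * ϱ ^ j) (_hAQ : ∑ j ∈ Finset.range (n + 1), αU j ≤ AQ)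
        (hpos' : ∀ x : SiteL2K ℂ d (towerP L m (n + 1)) c₀ W, x ≠ 0 → 0 < RCLike.re ⟪x, laplacePrimeAk L m n φ η U a' (c₁ := c₁) x⟫_ℂ)
        (hpos : ∀ x : BondL2K ℂ d (towerP L m (n + 1)) c₀ W, x ≠ 0 →
          0 < RCLike.re ⟪x, laplaceAk L m n φ η U hL αU hα1 hU1 hreg τ (c₀ := c₀) (c₁ := c₁) a x⟫_ℂ)
        (hposπ : ∀ x : BondL2K ℂ d (towerP L m (n + 1)) c₀ W, x ≠ 0 →
          0 < RCLike.re ⟪x, laplaceAkPi L m n φ τ η U a' hpos' hL αU hα1 hU1 hreg (c₁ := c₁) a x⟫_ℂ)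
        (_hc₀ : c₀ = η ^ d)
        (_hJ : ∀ (μ : Fin d) (y : TSite d (towerP L m (n + 1))),
          ‖B9Eq39Adjoint.J (fun μ => B9Eq33CovDerivVector.shiftEquiv μ) (fun μ y => U (y, μ)) η μ y‖ ≤ α)
        (v : TSite d m) (f : BondL2K ℂ d (towerP L m (n + 1)) c₀ W) (F : ℝ)
        (_hfv : ∀ b, blockCoord (L ^ (n + 1)) m (siteCast (towerP_eq_fineP_pow L m (n + 1)) (bpos b)) ≠ v →
          WL2.equiv ℂ (fun _ : Bond d (towerP L m (n + 1)) => c₀) W f b = 0)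
        (_hfF : ∀ b, ‖WL2.equiv ℂ (fun _ : Bond d (towerP L m (n + 1)) => c₀) W f b‖ ≤ F) (b : Bond d (towerP L m (n + 1))),
        ‖WL2.equiv ℂ (fun _ : Bond d (towerP L m (n + 1)) => c₀) W
            (G1LatticeK hposπ (covDerivL2K ℂ c₀ ((η : ℂ))⁻¹ (adTransportW φ U) (RofUk L m n φ η U
              (covDivL2K ℂ c₀ ((η : ℂ))⁻¹ (adTransportW φ fun bb => (U bb)⁻¹) (G1LatticeK hposπ f))))) b‖ ≤
          B * Real.exp (-(δ * tdist m (blockCoord (L ^ (n + 1)) m (siteCast (towerP_eq_fineP_pow L m (n + 1)) (btgt b))) v)) * F := by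
  classical
  obtain ⟨αR, BR, δR, hαR, hBR, hδR, HR⟩ := exists_local_rows_G1kPi hd L hL hL3 φ hMφ hMφ' hφ hφ' hstar ha ha' hϱ0 hϱ1 τ hτ hCτ hτm hMτ hρw hτ₁ hτ₂ hφτ AQ
  obtain ⟨α3, B3, δ3, hα3, hB3, hδ3, H3⟩ := exists_local_gradLetter_GpRk hd L hL hL3 φ hMφ hMφ' hφ hφ' ha ha' hϱ0 hϱ1 τ hτ hCτ hMτ hρw hτ₁ hτ₂ hφτ AQ
  obtain ⟨κ, hκd⟩ : ∃ κ : ℝ, κ = min δR δ3 / 2 := ⟨_, rfl⟩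
  have hκ0 : 0 < κ := by rw [hκd]; exact half_pos (lt_min hδR hδ3)
  have hκR : κ ≤ δR := by rw [hκd]; linarith [min_le_left δR δ3, (lt_min hδR hδ3).le]
  have hκ3 : κ < δ3 := by rw [hκd]; linarith [min_le_right δR δ3, lt_min hδR hδ3]
  have hK : 0 ≤ latticeConst d (δ3 - κ) := latticeConst_nonneg d (by linarith)
  refine ⟨min αR α3, BR * B3 * latticeConst d (δ3 - κ), κ, lt_min hαR hα3, by positivity, hκ0, ?_⟩
  intro n η hηL c₀ c₁ _ _ hw hρ m _ hm U αU hα0 hα1 hU1 hreg εU hεU hUε hLb α hα hαle hUst hUb hUη hpl hUgrad hRlev hεg hAQ hpos' hpos hposπ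
    hc₀ hJ v f F hfv hfF b
  have hαR' : α ≤ αR := hαle.trans (min_le_left _ _)
  have hα3' : α ≤ α3 := hαle.trans (min_le_right _ _)
  haveI : Nonempty (Bond d (towerP L m (n + 1))) := ⟨b⟩
  -- §1: the word is `D_UG′_kR_k` after `D*_UG̃_k`
  rw [G1LatticeKPi_covDerivL2K_RofUk L m n φ τ η U a' hpos' hL αU hα1 hU1 hreg a hposπ]
  -- the two maps as CLMs
  obtain ⟨T₁, hT₁⟩ : ∃ T : BondL2K ℂ d (towerP L m (n + 1)) c₀ W →L[ℂ] SiteL2K ℂ d (towerP L m (n + 1)) c₀ W,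
      T = LinearMap.toContinuousLinearMap (covDivL2K ℂ c₀ ((η : ℂ))⁻¹ (adTransportW φ fun bb => (U bb)⁻¹) ∘ₗ G1LatticeK hposπ) := ⟨_, rfl⟩
  obtain ⟨T₂, hT₂⟩ : ∃ T : SiteL2K ℂ d (towerP L m (n + 1)) c₀ W →L[ℂ] BondL2K ℂ d (towerP L m (n + 1)) c₀ W,
      T = LinearMap.toContinuousLinearMap (covDerivL2K ℂ c₀ ((η : ℂ))⁻¹ (adTransportW φ U) ∘ₗ GpOfUk L m n φ η U a' (c₁ := c₁) hpos' ∘ₗ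
        RofUk L m n φ η U (c₀ := c₀)) := ⟨_, rfl⟩
  have h₁ : ∀ (v : TSite d m) (f : BondL2K ℂ d (towerP L m (n + 1)) c₀ W) (F : ℝ),
      (∀ b, blockCoord (L ^ (n + 1)) m (siteCast (towerP_eq_fineP_pow L m (n + 1)) (bpos b)) ≠ v →
        WL2.equiv ℂ (fun _ : Bond d (towerP L m (n + 1)) => c₀) W f b = 0) →
      (∀ b, ‖WL2.equiv ℂ (fun _ : Bond d (towerP L m (n + 1)) => c₀) W f b‖ ≤ F) →
      ∀ y, ‖WL2.equiv ℂ (fun _ : TSite d (towerP L m (n + 1)) => c₀) W (T₁ f) y‖ ≤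
        BR * Real.exp (-(δR * tdist m (blockCoord (L ^ (n + 1)) m (siteCast (towerP_eq_fineP_pow L m (n + 1)) y)) v)) * F := by
    intro v f F hfv hfF y
    rw [hT₁, LinearMap.coe_toContinuousLinearMap', LinearMap.comp_apply]
    exact (HR n η hηL c₀ c₁ hw hρ m hm U αU hα0 hα1 hU1 hreg εU hεU hUε hLb α hα hαR' hUst hUb hUη hpl hUgrad hRlev hεg hAQ hpos' hpos hposπ hc₀ hJ
      v f F hfv hfF ⟨0, hd⟩ b y).2.1
  have h₂ : ∀ (v : TSite d m) (w : SiteL2K ℂ d (towerP L m (n + 1)) c₀ W) (F : ℝ),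
      (∀ x, blockCoord (L ^ (n + 1)) m (siteCast (towerP_eq_fineP_pow L m (n + 1)) x) ≠ v →
        WL2.equiv ℂ (fun _ : TSite d (towerP L m (n + 1)) => c₀) W w x = 0) →
      (∀ x, ‖WL2.equiv ℂ (fun _ : TSite d (towerP L m (n + 1)) => c₀) W w x‖ ≤ F) →
      ∀ b', ‖WL2.equiv ℂ (fun _ : Bond d (towerP L m (n + 1)) => c₀) W (T₂ w) b'‖ ≤
        B3 * Real.exp (-(δ3 * tdist m (blockCoord (L ^ (n + 1)) m (siteCast (towerP_eq_fineP_pow L m (n + 1)) (btgt b'))) v)) * F := by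
    intro v w F hwv hwF b'
    rw [hT₂, LinearMap.coe_toContinuousLinearMap', LinearMap.comp_apply, LinearMap.comp_apply]
    exact H3 n η hηL c₀ c₁ hw hρ m hm U αU hα0 hα1 hU1 hreg εU hεU hUε hLb α hα hα3' hUst hUb hUη hpl hUgrad hRlev hεg hAQ hpos' v w F hwv hwF b'
  have hS : ∀ w', ∑ u, Real.exp (-((δ3 - κ) * tdist m w' u)) ≤ latticeConst d (δ3 - κ) := fun w' => torusSum_le d hm (sub_pos.2 hκ3) w'
  have h := letter_comp (𝕜 := ℂ) (tdist m)
    (fun b' : Bond d (towerP L m (n + 1)) => blockCoord (L ^ (n + 1)) m (siteCast (towerP_eq_fineP_pow L m (n + 1)) (bpos b')))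
    (fun x : TSite d (towerP L m (n + 1)) => blockCoord (L ^ (n + 1)) m (siteCast (towerP_eq_fineP_pow L m (n + 1)) x))
    (fun b' : Bond d (towerP L m (n + 1)) => blockCoord (L ^ (n + 1)) m (siteCast (towerP_eq_fineP_pow L m (n + 1)) (btgt b')))
    T₁ T₂ (tdist_nonneg m) (fun u y w' => tdist_triangle hm u y w') hBR hB3 hκ0.le hκR h₁ h₂ hS v f F hfv hfF b
  rw [ContinuousLinearMap.comp_apply, hT₁, hT₂, LinearMap.coe_toContinuousLinearMap', LinearMap.coe_toContinuousLinearMap',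
    LinearMap.comp_apply, LinearMap.comp_apply, LinearMap.comp_apply] at h
  exact h

end Row

end Literature.MathematicalPhysics.QuantumFieldTheory.Balaban1983to89.B9Eq3152GtildeThirdWordSupRowClosed

end
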